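import Summits.QuantumAdvantage.QuantumAdvantage.Theorems.SymplecticPurityNoFreeFrameCoord
import Summits.QuantumAdvantage.QuantumAdvantage.Theorems.SymplecticPurityGoldFamilyState

/-!
# Route `SymplecticPurity`, crux `DeqThesis`, line `Sketch` — the two-Gold-map program computes `y ↦ (y³, y⁵)`

For the good input lengths `n = 2·3^k` the Boolean map `goldMap n` of the two-Gold-map program
`goldOpsA n = cubeOpsA n ++ pentOpsA n` is the pair of Gold maps of the field
`K = 𝔽₂[X]/(Φ_{3^{k+1}})` read in the power-basis coordinates `e = cubeEquiv k`:

  `goldMap n y = Fin.append (l ↦ [e((e⁻¹ y)³)_l = 1]) (l ↦ [e((e⁻¹ y)⁵)_l = 1])`   (`goldMap_eq_gold`).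

Steps (the verbatim analogue of `SymplecticPurityNoFreeFrameCoord` for the second value register):
the first value register (wires `n … 2n-1`) is untouched by `pentOpsA n` (its targets are `≥ 2n`),
so there `goldMap n y` is `cubeMap n y` (`goldMap_castAdd`, any `n`) and `cubeMap_eq_cube` applies;
in `K`, `(Σ cᵢ αⁱ)⁵ = Σ_{i,j} cᵢ cⱼ α^{i+4j}` by Frobenius twice (`pent_expand`); and on the second value
register the program is an XOR network (`clEval_xor`) in which only the `pentOpsA` gates fire, so bit
`l` is the parity `Σ_i cᵢ [l ∈ E(5i)] + Σ_{i≠j} cᵢ cⱼ [l ∈ E(i+4j)]` (`pentOpsA_parity`) — the same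
double sum with its diagonal separated (`sum_sum_split_diag_four`).
-/

noncomputable section

set_option linter.dupNamespace false -- D-0017: single-problem summit ⇒ `QuantumAdvantage.QuantumAdvantage` by design

namespace Summit.QuantumAdvantage.QuantumAdvantage.Theorems.SymplecticPurity

open Polynomial
open Literature.Computability.QuantumComplexity Literature.Computability.Cryptography

section Field

variable (k : ℕ)

/-! ### The fifth power in `𝔽₂[X]/(Φ_{3^{k+1}})` (`α = AdjoinRoot.root (cubePoly k)`, the class of `X`) -/

/-- **The fifth power of `Σ cᵢ αⁱ` is `Σ_{i,j} cᵢ cⱼ α^{i+4j}`** (`x⁵ = x·(x²)²`, Frobenius twice in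
characteristic `2`). -/
theorem pent_expand (c : Fin (2 * 3 ^ k) → ZMod 2) :
    ((cubeEquiv k).symm c) ^ 5 =
      ∑ i, ∑ j, (c i * c j) • (AdjoinRoot.root (cubePoly k)) ^ ((i : ℕ) + 4 * (j : ℕ)) := by
  haveI := expChar_cubeField k
  rw [cubeEquiv_symm_apply, pow_succ', show (4 : ℕ) = 2 * 2 from rfl, pow_mul, sum_pow_char 2,
    sum_pow_char 2, Finset.sum_mul_sum]
  refine Finset.sum_congr rfl fun i _ => Finset.sum_congr rfl fun j _ => ?_
  rw [_root_.smul_pow, ZMod.pow_card, _root_.smul_pow, ZMod.pow_card, ← pow_mul, ← pow_mul,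
    smul_mul_smul_comm, ← pow_add, show (j : ℕ) * (2 * 2) = 4 * (j : ℕ) by ring]

/-- **Coordinates of the fifth power**: `e((e⁻¹c)⁵)_l = Σ_{i,j} cᵢ cⱼ · e(α^{i+4j})_l`. -/
theorem cubeEquiv_fifth (c : Fin (2 * 3 ^ k) → ZMod 2) (l : Fin (2 * 3 ^ k)) :
    cubeEquiv k (((cubeEquiv k).symm c) ^ 5) l =
      ∑ i : Fin (2 * 3 ^ k), ∑ j : Fin (2 * 3 ^ k),
        c i * c j * cubeEquiv k ((AdjoinRoot.root (cubePoly k)) ^ ((i : ℕ) + 4 * (j : ℕ))) l := by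
  rw [pent_expand, cubeEquiv_apply, map_sum, Finset.sum_apply]
  refine Finset.sum_congr rfl fun i _ => ?_
  rw [map_sum, Finset.sum_apply]
  refine Finset.sum_congr rfl fun j _ => ?_
  rw [map_smul, Pi.smul_apply, smul_eq_mul, cubeEquiv_apply]

end Field

/-! ### The program side -/

/-- The zero-padding of `y`, extended by `0` to `ℕ`, read at any wire. -/
theorem liftW_padInput_apply {n : ℕ} (y : Fin n → Bool) (m i : ℕ) :
    RevSim.liftW (padInput y m) i = if h : i < n then y ⟨i, h⟩ else false := by
  unfold RevSim.liftW padInput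
  split_ifs with h1 h2 h2
  · exact Fin.append_left y (fun _ => false) ⟨i, h2⟩
  · rw [show (⟨i, h1⟩ : Fin (n + m)) = Fin.natAdd n ⟨i - n, by omega⟩ from Fin.ext (by simp; omega),
      Fin.append_right]
  · omega
  · rfl

/-- The zero-padding of `y`, extended by `0` to `ℕ`, does not depend on the number of pads. -/
theorem liftW_padInput {n : ℕ} (y : Fin n → Bool) (m m' : ℕ) :
    RevSim.liftW (padInput y m) = RevSim.liftW (padInput y m') := by
  funext i
  rw [liftW_padInput_apply, liftW_padInput_apply]

/-- **On the first value register the two-Gold-map program computes `cubeMap`** (any input length: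
the fifth-power gates only hit the second value register). -/
theorem goldMap_castAdd (n : ℕ) (y : Fin n → Bool) (l : Fin n) :
    goldMap n y (Fin.castAdd n l) = cubeMap n y l := by
  show clEval (cubeOpsA n ++ pentOpsA n) (RevSim.liftW (padInput y (n + n))) (n + l) =
    clEval (cubeOpsA n) (RevSim.liftW (padInput y n)) (n + l)
  rw [clEval_append, clEval_apply_of_forall_target_ne _ _ (fun op hop h => ?_),
    liftW_padInput y (n + n) n]
  have := le_target_of_mem_pentOpsA hop
  have := l.isLt
  omega

/-- Controls of the fifth-power program are input wires. -/
theorem controls_lt_of_mem_pentOpsA {n : ℕ} {op : ClOp ℕ} (hop : op ∈ pentOpsA n) :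
    ∀ c ∈ op.controls, c < n := by
  simp only [pentOpsA, pentLinOps, pentQuadOps, List.mem_append, List.mem_flatMap, List.mem_map,
    List.mem_range] at hop
  rcases hop with ⟨a, ha, l, -, rfl⟩ | ⟨a, ha, b, hb, hop⟩
  · simp [ClOp.controls, ha]
  · split_ifs at hop
    · simp at hop
    · rw [List.mem_map] at hop
      obtain ⟨l, -, rfl⟩ := hop
      simp [ClOp.controls, ha, hb]

/-- Controls of the two-Gold-map program are input wires. -/
theorem controls_lt_of_mem_goldOpsA {n : ℕ} {op : ClOp ℕ} (hop : op ∈ goldOpsA n) :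
    ∀ c ∈ op.controls, c < n := by
  rcases List.mem_append.1 hop with h | h
  · exact controls_lt_of_mem_cubeOpsA h
  · exact controls_lt_of_mem_pentOpsA h

/-! ### The main identification on the second value register -/

section Main

variable (k : ℕ)

/-- The parity, over the fifth-power program, of the guards of the gates hitting wire `n + n + l`,
as an element of `𝔽₂`: `Σ_i c_i C(5i) + Σ_i Σ_{j ≠ i} c_i c_j C(i + 4j)` with `c_i = [w i]` and
`C(m) = e(α^m)_l`. -/
theorem pentOpsA_parity (w : ℕ → Bool) (l : Fin (2 * 3 ^ k)) :
    (((pentOpsA (2 * 3 ^ k)).map fun op =>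
        if (decide (op.target = (2 * 3 ^ k) + (2 * 3 ^ k) + (l : ℕ)) && op.guard w) then (1 : ZMod 2)
        else 0).sum) =
      (∑ i ∈ Finset.range (2 * 3 ^ k),
          (if w i then (1 : ZMod 2) else 0) * cubeEquiv k ((AdjoinRoot.root (cubePoly k)) ^ (5 * i)) l) +
      ∑ i ∈ Finset.range (2 * 3 ^ k), ∑ j ∈ Finset.range (2 * 3 ^ k),
        if i = j then 0 else
          (if w i then (1 : ZMod 2) else 0) * (if w j then 1 else 0) *
            cubeEquiv k ((AdjoinRoot.root (cubePoly k)) ^ (i + 4 * j)) l := by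
  have hdiv : (2 * 3 ^ k) / 2 = 3 ^ k := by omega
  -- one chunk of gates onto the second value register, all with the same guard value `g`
  have hchunk : ∀ (m : ℕ) (g : ZMod 2) (mk : ℕ → ClOp ℕ),
      (∀ l', (mk l').target = (2 * 3 ^ k) + (2 * 3 ^ k) + l') →
      (∀ l', (if (mk l').guard w then (1 : ZMod 2) else 0) = g) →
      (((cubeExps (3 ^ k) m).map mk).map fun op =>
          if (decide (op.target = (2 * 3 ^ k) + (2 * 3 ^ k) + (l : ℕ)) && op.guard w) then (1 : ZMod 2)
          else 0).sum =
        g * cubeEquiv k ((AdjoinRoot.root (cubePoly k)) ^ m) l := by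
    intro m g mk htgt hguard
    rw [cubeEquiv_root_pow, List.map_map, mul_comm g, ← List.sum_map_mul_right]
    congr 1
    refine List.map_congr_left fun l' _ => ?_
    rw [Function.comp_apply, ite_and, hguard, htgt]
    congr 1
    simp [eq_comm]
  rw [pentOpsA, List.map_append, List.sum_append]
  congr 1
  · -- the linear part
    rw [pentLinOps, List.map_flatMap, sum_flatMap, sum_map_range, hdiv]
    refine Finset.sum_congr rfl fun i _ => ?_
    exact hchunk (5 * i) _ (fun l' => ClOp.cnot i ((2 * 3 ^ k) + (2 * 3 ^ k) + l')) (fun _ => rfl)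
      (fun _ => rfl)
  · -- the quadratic part
    rw [pentQuadOps, List.map_flatMap, sum_flatMap, sum_map_range, hdiv]
    refine Finset.sum_congr rfl fun i _ => ?_
    rw [List.map_flatMap, sum_flatMap, sum_map_range]
    refine Finset.sum_congr rfl fun j _ => ?_
    by_cases hij : i = j
    · simp [hij]
    · rw [if_neg hij, if_neg hij]
      exact hchunk (i + 4 * j) _ (fun l' => ClOp.toffoli i j ((2 * 3 ^ k) + (2 * 3 ^ k) + l'))
        (fun _ => rfl) (fun _ => by rw [← ite_and]; rfl)

/-- Over the whole two-Gold-map program only the fifth-power gates hit wire `n + n + l` (the cube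
gates live on wires `< n + n`). -/
theorem goldOpsA_parity_right (w : ℕ → Bool) (l : Fin (2 * 3 ^ k)) :
    (((goldOpsA (2 * 3 ^ k)).map fun op =>
        if (decide (op.target = (2 * 3 ^ k) + (2 * 3 ^ k) + (l : ℕ)) && op.guard w) then (1 : ZMod 2)
        else 0).sum) =
      ((pentOpsA (2 * 3 ^ k)).map fun op =>
        if (decide (op.target = (2 * 3 ^ k) + (2 * 3 ^ k) + (l : ℕ)) && op.guard w) then (1 : ZMod 2)
        else 0).sum := by
  rw [goldOpsA, List.map_append, List.sum_append, add_eq_right]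
  refine List.sum_eq_zero fun x hx => ?_
  obtain ⟨op, hop, rfl⟩ := List.mem_map.1 hx
  have hlt := cubeOpsA_wires op hop op.target (by simp)
  have hne : op.target ≠ (2 * 3 ^ k) + (2 * 3 ^ k) + (l : ℕ) := by omega
  simp [hne]

/-- Splitting the diagonal off a double sum over `range n × range n` in `𝔽₂` (exponents `i + 4j`,
diagonal `5i`). -/
theorem sum_sum_split_diag_four (n : ℕ) (c : ℕ → ZMod 2) (hc : ∀ i, c i * c i = c i)
    (C : ℕ → ZMod 2) :
    (∑ i ∈ Finset.range n, ∑ j ∈ Finset.range n, c i * c j * C (i + 4 * j)) =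
      (∑ i ∈ Finset.range n, c i * C (5 * i)) +
        ∑ i ∈ Finset.range n, ∑ j ∈ Finset.range n,
          if i = j then 0 else c i * c j * C (i + 4 * j) := by
  rw [← Finset.sum_add_distrib]
  refine Finset.sum_congr rfl fun i hi => ?_
  have hsplit : ∀ j, c i * c j * C (i + 4 * j) = (if i = j then c i * c j * C (i + 4 * j) else 0) +
      (if i = j then 0 else c i * c j * C (i + 4 * j)) := fun j => by
    by_cases h : i = j <;> simp [h]
  rw [Finset.sum_congr rfl fun j _ => hsplit j, Finset.sum_add_distrib, Finset.sum_ite_eq, if_pos hi,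
    hc, show i + 4 * i = 5 * i by ring]

/-- **On the second value register the two-Gold-map program computes the fifth-power map of
`𝔽₂[X]/(Φ_{3^{k+1}})` in power-basis coordinates**, as an identity in `𝔽₂`. -/
theorem ite_goldMap_natAdd_eq (y : Fin (2 * 3 ^ k) → Bool) (l : Fin (2 * 3 ^ k)) :
    (if goldMap (2 * 3 ^ k) y (Fin.natAdd (2 * 3 ^ k) l) then (1 : ZMod 2) else 0) =
      cubeEquiv k (((cubeEquiv k).symm fun i => if y i then 1 else 0) ^ 5) l := by
  have hwi : ∀ i : Fin (2 * 3 ^ k),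
      RevSim.liftW (padInput y ((2 * 3 ^ k) + (2 * 3 ^ k))) i = y i := fun i => by
    rw [show (i : ℕ) = ((Fin.castAdd ((2 * 3 ^ k) + (2 * 3 ^ k)) i :
        Fin ((2 * 3 ^ k) + ((2 * 3 ^ k) + (2 * 3 ^ k)))) : ℕ) from rfl, RevSim.liftW_val]
    exact Fin.append_left _ _ _
  have hwl : RevSim.liftW (padInput y ((2 * 3 ^ k) + (2 * 3 ^ k)))
      ((2 * 3 ^ k) + (2 * 3 ^ k) + l) = false := by
    rw [show (2 * 3 ^ k) + (2 * 3 ^ k) + (l : ℕ) =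
        ((Fin.natAdd (2 * 3 ^ k) (Fin.natAdd (2 * 3 ^ k) l) :
          Fin ((2 * 3 ^ k) + ((2 * 3 ^ k) + (2 * 3 ^ k)))) : ℕ) from Nat.add_assoc _ _ _,
      RevSim.liftW_val]
    exact Fin.append_right _ _ _
  generalize hw : RevSim.liftW (padInput y ((2 * 3 ^ k) + (2 * 3 ^ k))) = w at hwi hwl
  -- program side
  have hprog : goldMap (2 * 3 ^ k) y (Fin.natAdd (2 * 3 ^ k) l) = (goldOpsA (2 * 3 ^ k)).foldr
      (fun op acc => (decide (op.target = (2 * 3 ^ k) + (2 * 3 ^ k) + (l : ℕ)) && op.guard w) ^^ acc) false := by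
    show clEval (goldOpsA (2 * 3 ^ k)) (RevSim.liftW (padInput y ((2 * 3 ^ k) + (2 * 3 ^ k))))
      ((2 * 3 ^ k) + ((2 * 3 ^ k) + l)) = _
    rw [hw, ← Nat.add_assoc, clEval_xor (2 * 3 ^ k) (goldOpsA (2 * 3 ^ k))
      (fun op hop => controls_lt_of_mem_goldOpsA hop) (fun op hop => le_target_of_mem_goldOpsA hop)
      w w (fun _ _ => rfl) ((2 * 3 ^ k) + (2 * 3 ^ k) + l), hwl, Bool.false_xor]
  rw [hprog, show (goldOpsA (2 * 3 ^ k)).foldr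
      (fun op acc => (decide (op.target = (2 * 3 ^ k) + (2 * 3 ^ k) + (l : ℕ)) && op.guard w) ^^ acc) false =
      ((goldOpsA (2 * 3 ^ k)).map fun op =>
        decide (op.target = (2 * 3 ^ k) + (2 * 3 ^ k) + (l : ℕ)) && op.guard w).foldr xor false
      from List.foldr_map.symm, ite_foldr_xor, List.map_map]
  rw [show ((fun b : Bool => if b then (1 : ZMod 2) else 0) ∘ fun op : ClOp ℕ =>
      decide (op.target = (2 * 3 ^ k) + (2 * 3 ^ k) + ↑l) && op.guard w) = fun op =>
      if (decide (op.target = (2 * 3 ^ k) + (2 * 3 ^ k) + (l : ℕ)) && op.guard w) then (1 : ZMod 2) else 0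
      from rfl, goldOpsA_parity_right k w l, pentOpsA_parity k w l]
  -- field side
  rw [cubeEquiv_fifth]
  have hrhs : (∑ i : Fin (2 * 3 ^ k), ∑ j : Fin (2 * 3 ^ k),
      (if y i then (1 : ZMod 2) else 0) * (if y j then 1 else 0) *
        cubeEquiv k ((AdjoinRoot.root (cubePoly k)) ^ ((i : ℕ) + 4 * (j : ℕ))) l) =
      ∑ i ∈ Finset.range (2 * 3 ^ k), ∑ j ∈ Finset.range (2 * 3 ^ k),
        (if w i then (1 : ZMod 2) else 0) * (if w j then 1 else 0) *
          cubeEquiv k ((AdjoinRoot.root (cubePoly k)) ^ (i + 4 * j)) l := by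
    rw [← Fin.sum_univ_eq_sum_range (fun i => ∑ j ∈ Finset.range (2 * 3 ^ k),
      (if w i then (1 : ZMod 2) else 0) * (if w j then 1 else 0) *
        cubeEquiv k ((AdjoinRoot.root (cubePoly k)) ^ (i + 4 * j)) l) (2 * 3 ^ k)]
    refine Finset.sum_congr rfl fun i _ => ?_
    rw [← Fin.sum_univ_eq_sum_range (fun j =>
      (if w i then (1 : ZMod 2) else 0) * (if w j then 1 else 0) *
        cubeEquiv k ((AdjoinRoot.root (cubePoly k)) ^ ((i : ℕ) + 4 * j)) l) (2 * 3 ^ k)]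
    refine Finset.sum_congr rfl fun j _ => ?_
    rw [hwi i, hwi j]
  rw [hrhs, sum_sum_split_diag_four (2 * 3 ^ k) (fun i => if w i then (1 : ZMod 2) else 0) (fun i => by
    cases w i <;> simp) (fun m => cubeEquiv k ((AdjoinRoot.root (cubePoly k)) ^ m) l)]

end Main

/-- **`goldMap (2·3^k)` is the pair of Gold maps `(y³, y⁵)` of `𝔽₂[X]/(Φ_{3^{k+1}})` in power-basis
coordinates**, in exactly the Boolean dress of line `Sketch` (registered sub-goal `goldMap_eq_gold`,
part (b) of `stub_goldState`). -/
theorem goldMap_eq_gold : ∀ (k : ℕ) (y : Fin (2 * 3 ^ k) → Bool),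
    goldMap (2 * 3 ^ k) y =
      Fin.append
        (fun l : Fin (2 * 3 ^ k) =>
          decide (cubeEquiv k (((cubeEquiv k).symm fun i => if y i then 1 else 0) ^ 3) l = 1))
        (fun l : Fin (2 * 3 ^ k) =>
          decide (cubeEquiv k (((cubeEquiv k).symm fun i => if y i then 1 else 0) ^ 5) l = 1)) := by
  intro k y
  funext j
  refine Fin.addCases (fun l => ?_) (fun l => ?_) j
  · rw [Fin.append_left, goldMap_castAdd, cubeMap_eq_cube k y]
  · rw [Fin.append_right]
    have h := ite_goldMap_natAdd_eq k y l
    cases hb : goldMap (2 * 3 ^ k) y (Fin.natAdd (2 * 3 ^ k) l)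
    · rw [hb, if_neg Bool.false_ne_true] at h
      rw [← h]; decide
    · rw [hb, if_pos rfl] at h
      rw [← h]; decide

end Summit.QuantumAdvantage.QuantumAdvantage.Theorems.SymplecticPurity
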